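import Literature.AlgebraicGeometry.HodgeTheory.PencilStepBelowMiddleHolds
import Literature.AlgebraicGeometry.HodgeTheory.HardLefschetzNFoldHolds
import Literature.AlgebraicGeometry.HodgeTheory.HodgeConjecture
import HarnessLib

/-!
# `stub_hodgeBelowLevel` — THE HODGE CONJECTURE IN EVERY DIMENSION `< 2m`, GRANTED THE MIDDLE LEVELS `< m`

Registered stub `stub_hodgeBelowLevel` of line `birth` (skeleton v2) of crux `SummitGrantedFourfolds`
(stmt-HodgeConjecture-14600, route `NoetherLefschetzOneUp` of `HodgeConjecture`): Brosnan–Fang–Nie–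
Pearlstein 2009, Lemma 48 ("the Hodge conjecture in all dimensions and codimensions follows from the
Hodge conjecture for the middle cohomology of even-dimensional varieties"), TRUNCATED AT LEVEL `m`:
if every rational `(m',m')`-class on every smooth projective complex `2m'`-fold is algebraic for all
`m' < m`, then on every smooth projective complex variety `X` of dimension `d < 2m` every rational
`(p,p)`-class `c ∈ H²ᵖ(X(ℂ); ℂ)`, every `p`, lies in `algebraicClasses X p`.

PROOF (all inputs are theorems of the tree; no named fact, no `sorry`). Strong induction on `d`.
For `X` smooth projective of dimension `d < 2m` and `c` rational of type `(p,p)` in degree `2p`: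

* `2p < d`: write `d = d' + 1`; the UNCONDITIONAL pencil step below the middle
  `mem_algebraicClasses_of_two_mul_le` (de Cataldo–Migliorini 2009 §4, proof of Prop. 4.5;
  Thomas 2005 §2, proof of Prop. 2; file `HodgeTheory/PencilStepBelowMiddleHolds`) fed with the
  induction hypothesis in dimension `d'` (all codimensions);
* `2p = d`: the granted middle level `p = d/2 < m`;
* `2p > d`: hard Lefschetz (Voisin I Thm. 6.25), `mem_algebraicClasses_of_lt_of_nonempty` fed with
  the discharged fact `nonempty_hardLefschetzNFold_holds d X` (files `HodgeTheory/HardLefschetzNFold`,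
  `HodgeTheory/HardLefschetzNFoldHolds`), from the two previous cases in degree `2(d - p) ≤ d`.

## References

* [BrosnanFangNiePearlstein2009] P. Brosnan, H. Fang, Z. Nie, G. Pearlstein, Singularities of
  admissible normal functions, Invent. Math. 177 (2009), §6 Lemma 48.
* [DecataldoMigliorini2009] M. A. de Cataldo, L. Migliorini, On singularities of primitive
  cohomology classes, Proc. AMS 137 (2009), §4 Prop. 4.5 (arXiv:0711.1307v1 pp. 10–11).
* [Thomas2005Nodes] R. P. Thomas, Nodes and the Hodge conjecture, J. Algebraic Geom. 14 (2005), §2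
  Prop. 2.
* [VoisinHodgeI2002] C. Voisin, Hodge Theory and Complex Algebraic Geometry I (2002), Thm. 6.25.
-/

-- `Summit.HodgeConjecture.HodgeConjecture.Theorems` is the mandated namespace (single-problem summit),
-- flagged by `linter.dupNamespace`; the lakefile turns the linter off tree-wide, restated here.
set_option linter.dupNamespace false

noncomputable section

open Literature.AlgebraicGeometry.Motives
open Literature.AlgebraicGeometry.HodgeTheory

namespace Summit.HodgeConjecture.HodgeConjecture.Theorems

/-- **The Hodge conjecture in every dimension `< 2m`, granted the middle levels `< m`** (BFNP 2009
Lemma 48 truncated at level `m`) — stub `stub_hodgeBelowLevel` of line `birth` of crux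
`SummitGrantedFourfolds`: if every rational `(m',m')`-class on every smooth projective complex
`2m'`-fold is algebraic for all `m' < m`, then for `X` smooth projective of dimension `d < 2m` every
rational `(p,p)`-class in `H²ᵖ(X(ℂ); ℂ)` lies in `algebraicClasses X p`. Strong induction on `d`:
below the middle the unconditional pencil step `mem_algebraicClasses_of_two_mul_le` from dimension
`d - 1`, at the middle the granted level `d/2 < m`, above the middle hard Lefschetz
(`mem_algebraicClasses_of_lt_of_nonempty (nonempty_hardLefschetzNFold_holds d X)`) from degree
`2(d - p) ≤ d`. [cite: BrosnanFangNiePearlstein2009, §6 Lemma 48]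
[cite: DecataldoMigliorini2009, §4 Prop. 4.5] [cite: Thomas2005Nodes, §2 Prop. 2]
[cite: VoisinHodgeI2002, Thm. 6.25] -/
theorem stub_hodgeBelowLevel :
    ∀ ⦃m : ℕ⦄, (∀ m' : ℕ, m' < m → ∀ ⦃X : Literature.AlgebraicGeometry.Motives.SchemeOver ℂ⦄, Literature.AlgebraicGeometry.Motives.IsSmoothProjective (2 * m') X → ∀ c : Literature.AlgebraicGeometry.HodgeTheory.complexBetti X (2 * m'), Literature.AlgebraicGeometry.HodgeTheory.IsRationalClass c → Literature.AlgebraicGeometry.HodgeTheory.IsOfHodgeType (2 * m') X (2 * m') m' m' c → c ∈ Literature.AlgebraicGeometry.HodgeTheory.algebraicClasses X m') → ∀ ⦃d : ℕ⦄, d < 2 * m → ∀ ⦃X : Literature.AlgebraicGeometry.Motives.SchemeOver ℂ⦄, Literature.AlgebraicGeometry.Motives.IsSmoothProjective d X → ∀ (p : ℕ) (c : Literature.AlgebraicGeometry.HodgeTheory.complexBetti X (2 * p)), Literature.AlgebraicGeometry.HodgeTheory.IsRationalClass c → Literature.AlgebraicGeometry.HodgeTheory.IsOfHodgeType d X (2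 * p) p p c → c ∈ Literature.AlgebraicGeometry.HodgeTheory.algebraicClasses X p := by
  intro m hlev d
  induction d using Nat.strong_induction_on with
  | _ d ih =>
    intro hd
    -- degrees at or below the middle: the pencil step (`2p < d`) and the granted level (`2p = d`)
    have hle : ∀ ⦃X : SchemeOver ℂ⦄, IsSmoothProjective d X → ∀ (p : ℕ) (c : complexBetti X (2 * p)),
        2 * p ≤ d → IsRationalClass c → IsOfHodgeType d X (2 * p) p p c →
          c ∈ algebraicClasses X p := by
      intro X hX p c hpd hc hpp
      obtain hlt | heq := Nat.lt_or_eq_of_le hpd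
      · -- `2p < d`: `d = d' + 1`, pencil step from dimension `d'` (induction hypothesis, all `q`)
        obtain ⟨d', rfl⟩ : ∃ d', d = d' + 1 := ⟨d - 1, by omega⟩
        exact mem_algebraicClasses_of_two_mul_le hX
          (fun Y hY q c' hc' hqq ↦ ih d' (Nat.lt_succ_self d') (by omega) hY q c' hc' hqq) p c
          (by omega) hc hpp
      · -- `2p = d`: the granted middle level `p < m`
        subst heq
        exact hlev p (by omega) hX c hc hpp
    intro X hX p c hc hpp
    obtain hlt | hge := Nat.lt_or_ge d (2 * p)
    · -- `2p > d`: hard Lefschetz from degree `2(d - p) ≤ d`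
      exact mem_algebraicClasses_of_lt_of_nonempty (nonempty_hardLefschetzNFold_holds d X) hX hlt
        (fun c' hc' hpp' ↦ hle hX (d - p) c' (by omega) hc' hpp') c hc hpp
    · exact hle hX p c hge hc hpp

end Summit.HodgeConjecture.HodgeConjecture.Theorems

end
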